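import Summits.NavierStokesRegularity.NavierStokesRegularity.Theorems.CoriolisHeadTypeIRatePressureKernel
import HarnessLib

/-!
# CoriolisHeadTypeIRatePressureRate — crux `NoCoRotatingCore` (stmt-NavierStokesRegularity-22676), line
# `far_field_constancy` v2 (skeleton 15c9a82ad206abb9), stub K1c `stub_typeIRate` — pressure half, file 2/3:
# a POWER RATE for `∇P − g` from a power decay of `ΔP`

`TypeIRate.abs_fderiv_sub_inner_le`: for `P ∈ C^∞(ℝ³)` with `|ΔP(w)| ≤ K₂(1 + ‖w‖)^{−q}`, `2 ≤ q < 3`, and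
`∇P → g` at infinity, for every `‖y‖ ≥ 1` and direction `e`,
`|∂ₑP(y) − ⟪g, e⟫| ≤ (16 C_Γ K₂ 2^q |B₁| (1+‖y‖)^{1−q} + 12 C_Γ K₂ |B₁| 20^{3−q}/(3−q) · (‖y‖/8)^{1−q}) ‖e‖`,
i.e. `∇P − g = O(‖y‖^{1−q})`.  Proof: two-sided DYADIC TELESCOPING of the centred shell means
`M_c = ∫ λ^{c,2c}(z) ∂ₑP(y+z) dz` over `c = 2^j‖y‖/8`, `j ∈ ℤ` — downwards `M_c → ∂ₑP(y)` by the approximate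
identity (`tendsto_integral_newtonFarLaplacian_smul`) with steps `≤ A₁ c (1+‖y‖)^{−q}` (file 1/3, small scales),
upwards `M_c → ⟪g, e⟫` by mass one and `∇P → g` (`abs_shellMean_sub_le`) with steps `≤ A₂ c^{1−q}` (large
scales); both series are geometric.  This is the mean-value/Green mechanism of Gilbarg–Trudinger §2–§4 run
scale by scale; no Newtonian potential of `ΔP` or `∂ΔP` is formed.

Used by file 3/3 (`…TypeIRateOfGradientDecay.lean`) with `|ΔP| ≤ 3‖DU‖²`.  Everything is proved; no definitions,
no named facts.  WHAT THIS IS NOT: K1c, K1a, `NoCoRotatingCore` stay OPEN; nothing here proves Pineau–Vicol's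
conjecture or NS regularity.

References: D. Gilbarg, N. S. Trudinger, *Elliptic PDE of second order* (2001), §2.7, §4.2 [GilbargTrudinger2001].
-/

noncomputable section

open MeasureTheory Set Function Filter Topology Metric InnerProductSpace Real
open scoped RealInnerProductSpace Laplacian ContDiff

-- the summit and its single sub-problem share the name (CONVENTIONS §1), as in every Theorems file
set_option linter.dupNamespace false

namespace Summit.NavierStokesRegularity.NavierStokesRegularity.Theorems.CoriolisHead

namespace TypeIRate

open Literature.Analysis.FluidPDE

/-! ## §4 Two-sided dyadic telescoping: a power rate for `∂ₑP − ⟪g, e⟫` -/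

/-- **Pointwise power rate for the pressure gradient.**  Let `P ∈ C^∞(ℝ³)` with
`|ΔP(w)| ≤ K₂(1 + ‖w‖)^{−q}`, `2 ≤ q < 3`, and `∇P → g` at infinity.  Then for `‖y‖ ≥ 1` and every `e`,
`|∂ₑP(y) − ⟪g, e⟫| ≤ (16·C_Γ K₂ 2^q |B₁| (1 + ‖y‖)^{1−q} + 12·C_Γ K₂ |B₁| 20^{3−q}/(3−q) · (‖y‖/8)^{1−q}) ‖e‖`.
Proof: telescope the centred shell means `M_c = ∫ λ^{c,2c}(z) ∂ₑP(y + z) dz` over the dyadic scales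
`c = 2^j ‖y‖/8`, `j ∈ ℤ`: downwards `M_c → ∂ₑP(y)` (approximate identity) with steps `≤ A₁ c` (small scales),
upwards `M_c → ⟪g, e⟫` (mass one, `∇P → g`) with steps `≤ A₂ c^{1−q}` (large scales); both series are geometric.
No Newtonian potential is formed and only `ΔP` (never `∂ΔP`) meets a kernel, so no monopole/cancellation issue
arises. [cite: GilbargTrudinger2001, §2.7–§4.2 (flavour)] -/
theorem abs_fderiv_sub_inner_le {C : ℝ} (hC0 : 0 ≤ C)
    (hC : ∀ w : EuclideanSpace ℝ (Fin 3), ‖w‖ ^ 2 * ‖fderiv ℝ (newtonFar 1 2) w‖ ≤ C)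
    {P : EuclideanSpace ℝ (Fin 3) → ℝ} (hP : ContDiff ℝ ∞ P) {K₂ q : ℝ} (hK₂ : 0 ≤ K₂) (hq2 : 2 ≤ q)
    (hq3 : q < 3) (hΔ : ∀ w : EuclideanSpace ℝ (Fin 3), |(Δ P) w| ≤ K₂ / (1 + ‖w‖) ^ q)
    {g : EuclideanSpace ℝ (Fin 3)}
    (hg : ∀ ε : ℝ, 0 < ε → ∃ R : ℝ, ∀ w : EuclideanSpace ℝ (Fin 3), R ≤ ‖w‖ → ‖gradient P w - g‖ ≤ ε)
    (y : EuclideanSpace ℝ (Fin 3)) (hy : 1 ≤ ‖y‖) (e : EuclideanSpace ℝ (Fin 3)) :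
    |fderiv ℝ P y e - ⟪g, e⟫| ≤
      (16 * C * K₂ * 2 ^ q * (volume (ball (0 : EuclideanSpace ℝ (Fin 3)) 1)).toReal * (1 + ‖y‖) ^ (1 - q) +
        12 * C * K₂ * (volume (ball (0 : EuclideanSpace ℝ (Fin 3)) 1)).toReal * (20 : ℝ) ^ (3 - q) / (3 - q) *
          (‖y‖ / 8) ^ (1 - q)) * ‖e‖ := by
  obtain ⟨V₁, hV₁⟩ : ∃ V : ℝ, V = (volume (ball (0 : EuclideanSpace ℝ (Fin 3)) 1)).toReal := ⟨_, rfl⟩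
  have hV₁0 : 0 ≤ V₁ := by rw [hV₁]; exact ENNReal.toReal_nonneg
  rw [← hV₁]
  have hq0 : 0 ≤ q := by linarith
  have hypos : 0 < ‖y‖ := one_pos.trans_le hy
  -- the centred shell means
  obtain ⟨S, hS⟩ : ∃ S : ℝ → ℝ, ∀ c, S c = ∫ z, newtonFarLaplacian c (2 * c) z * fderiv ℝ P (y + z) e :=
    ⟨_, fun _ => rfl⟩
  set c₀ : ℝ := ‖y‖ / 8 with hc₀
  have hc₀pos : 0 < c₀ := by positivity
  have hc₀y : 8 * c₀ = ‖y‖ := by rw [hc₀]; ring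
  -- the two step bounds
  set A₁ : ℝ := 128 * C * K₂ * 2 ^ q * V₁ * ‖e‖ / (1 + ‖y‖) ^ q with hA₁
  set A₂ : ℝ := 6 * C * K₂ * V₁ * (20 : ℝ) ^ (3 - q) / (3 - q) * ‖e‖ with hA₂
  have h1y : 0 < (1 + ‖y‖) ^ q := Real.rpow_pos_of_pos (by positivity) _
  have hA₁0 : 0 ≤ A₁ := by positivity
  have h3q : 0 < 3 - q := by linarith
  have hA₂0 : 0 ≤ A₂ := by positivity
  have hsmall : ∀ c : ℝ, 0 < c → 8 * c ≤ ‖y‖ → |S c - S (2 * c)| ≤ A₁ * c := by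
    intro c hc hcy
    have h := abs_shellStep_le_small hC0 hC hP hq0 hΔ y e hc hcy
    rw [← hV₁] at h
    rw [hS, hS, show 2 * (2 * c) = 4 * c by ring]
    refine h.trans (le_of_eq ?_)
    rw [hA₁]
    field_simp
  have hlarge : ∀ c : ℝ, 0 < c → ‖y‖ ≤ 8 * c → 1 ≤ 8 * c → |S c - S (2 * c)| ≤ A₂ * c ^ (1 - q) := by
    intro c hc hyc h1c
    have h := abs_shellStep_le_large hC0 hC hP hK₂ hq0 hq3 hΔ y e hc hyc h1c
    rw [← hV₁] at h
    rw [hS, hS, show 2 * (2 * c) = 4 * c by ring]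
    refine h.trans (le_of_eq ?_)
    rw [hA₂]
  -- downward telescoping
  have hdown : ∀ N : ℕ, |S (c₀ / 2 ^ N) - S c₀| ≤ A₁ * (c₀ - c₀ / 2 ^ N) := by
    intro N
    induction N with
    | zero => simp
    | succ N ih =>
      have hc : 0 < c₀ / 2 ^ (N + 1) := by positivity
      have h2c : 2 * (c₀ / 2 ^ (N + 1)) = c₀ / 2 ^ N := by
        rw [pow_succ]; field_simp
      have h8c : 8 * (c₀ / 2 ^ (N + 1)) ≤ ‖y‖ := by
        rw [← hc₀y]
        have h1 : (1 : ℝ) ≤ 2 ^ (N + 1) := one_le_pow₀ one_le_two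
        have : c₀ / 2 ^ (N + 1) ≤ c₀ := div_le_self hc₀pos.le h1
        linarith
      have hstep := hsmall _ hc h8c
      rw [h2c] at hstep
      have htri : |S (c₀ / 2 ^ (N + 1)) - S c₀| ≤
          |S (c₀ / 2 ^ (N + 1)) - S (c₀ / 2 ^ N)| + |S (c₀ / 2 ^ N) - S c₀| := abs_sub_le _ _ _
      have hgeom : c₀ / 2 ^ N - c₀ / 2 ^ (N + 1) = c₀ / 2 ^ (N + 1) := by
        rw [pow_succ]; field_simp; ring
      nlinarith [hgeom]
  -- upward telescoping
  have hup : ∀ N : ℕ, |S c₀ - S (c₀ * 2 ^ N)| ≤ 2 * A₂ * c₀ ^ (1 - q) * (1 - 1 / 2 ^ N) := by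
    intro N
    induction N with
    | zero => simp
    | succ N ih =>
      have h2N : (1 : ℝ) ≤ 2 ^ N := one_le_pow₀ one_le_two
      have hc : 0 < c₀ * 2 ^ N := by positivity
      have hyc : ‖y‖ ≤ 8 * (c₀ * 2 ^ N) := by rw [← hc₀y]; nlinarith
      have h1c : 1 ≤ 8 * (c₀ * 2 ^ N) := by rw [← hc₀y] at hy; nlinarith
      have hstep := hlarge _ hc hyc h1c
      rw [show 2 * (c₀ * 2 ^ N) = c₀ * 2 ^ (N + 1) by rw [pow_succ]; ring] at hstep
      -- `(c₀ 2^N)^{1-q} ≤ c₀^{1-q} / 2^N`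
      have hpow : (c₀ * 2 ^ N) ^ (1 - q) ≤ c₀ ^ (1 - q) / 2 ^ N := by
        rw [Real.mul_rpow hc₀pos.le (by positivity)]
        have h1 : ((2 : ℝ) ^ N) ^ (1 - q) ≤ ((2 : ℝ) ^ N) ^ (-1 : ℝ) :=
          Real.rpow_le_rpow_of_exponent_le h2N (by linarith)
        rw [Real.rpow_neg_one] at h1
        rw [div_eq_mul_inv]
        exact mul_le_mul_of_nonneg_left h1 (Real.rpow_nonneg hc₀pos.le _)
      have htri : |S c₀ - S (c₀ * 2 ^ (N + 1))| ≤
          |S c₀ - S (c₀ * 2 ^ N)| + |S (c₀ * 2 ^ N) - S (c₀ * 2 ^ (N + 1))| := abs_sub_le _ _ _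
      have hgeom : (1 : ℝ) / 2 ^ N - 1 / 2 ^ (N + 1) = 1 / 2 ^ (N + 1) := by
        rw [pow_succ]; field_simp; ring
      have h2N1 : (0 : ℝ) < 2 ^ (N + 1) := by positivity
      have hc₀q : 0 ≤ c₀ ^ (1 - q) := Real.rpow_nonneg hc₀pos.le _
      have hstep' : |S (c₀ * 2 ^ N) - S (c₀ * 2 ^ (N + 1))| ≤ A₂ * (c₀ ^ (1 - q) / 2 ^ N) :=
        hstep.trans (mul_le_mul_of_nonneg_left hpow hA₂0)
      have e1 : A₂ * (c₀ ^ (1 - q) / 2 ^ N) = 2 * A₂ * c₀ ^ (1 - q) * (1 / 2 ^ (N + 1)) := by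
        rw [pow_succ]; field_simp
      rw [e1] at hstep'
      nlinarith [hgeom, mul_nonneg (mul_nonneg (by norm_num : (0:ℝ) ≤ 2) hA₂0) hc₀q]
  -- the downward limit: approximate identity
  have hφc : Continuous fun z : EuclideanSpace ℝ (Fin 3) => fderiv ℝ P (y + z) e :=
    ((hP.continuous_fderiv (by simp)).comp (continuous_const.add continuous_id)).clm_apply continuous_const
  have hlim_down : Tendsto (fun N : ℕ => S (c₀ / 2 ^ N)) atTop (𝓝 (fderiv ℝ P y e)) := by
    have hT := tendsto_integral_newtonFarLaplacian_smul one_pos one_lt_two hφc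
    simp only [add_zero] at hT
    have hseq : Tendsto (fun N : ℕ => c₀ / 2 ^ N) atTop (𝓝[>] (0 : ℝ)) := by
      refine tendsto_nhdsWithin_iff.2 ⟨?_, Eventually.of_forall fun N => ?_⟩
      · have h := (tendsto_pow_atTop_nhds_zero_of_lt_one (by norm_num : (0 : ℝ) ≤ 1 / 2)
          (by norm_num : (1 : ℝ) / 2 < 1)).const_mul c₀
        rw [mul_zero] at h
        refine h.congr fun N => ?_
        rw [one_div, inv_pow, div_eq_mul_inv]
      · exact mem_Ioi.2 (by positivity)
    have h := hT.comp hseq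
    refine h.congr fun N => ?_
    simp only [Function.comp, smul_eq_mul, mul_one, hS]
    congr 1
    funext z
    rw [mul_comm (c₀ / 2 ^ N) 2]
  -- the upward limit: `∇P → g` on far shells
  have hlim_up : ∀ ε : ℝ, 0 < ε → ∃ N₀ : ℕ, ∀ N, N₀ ≤ N →
      |S (c₀ * 2 ^ N) - ⟪g, e⟫| ≤ (∫ w : EuclideanSpace ℝ (Fin 3), |newtonFarLaplacian 1 2 w|) * (ε * ‖e‖) := by
    intro ε hε
    obtain ⟨Rg, hRg⟩ := hg ε hε
    obtain ⟨N₀, hN₀⟩ := pow_unbounded_of_one_lt ((Rg + ‖y‖) / c₀) (one_lt_two : (1 : ℝ) < 2)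
    refine ⟨N₀, fun N hN => ?_⟩
    have hc : 0 < c₀ * 2 ^ N := by positivity
    have hcR : Rg + ‖y‖ ≤ c₀ * 2 ^ N := by
      have h1 : (Rg + ‖y‖) / c₀ < 2 ^ N :=
        hN₀.trans_le (pow_le_pow_right₀ one_le_two hN)
      rw [div_lt_iff₀ hc₀pos] at h1
      linarith
    rw [hS]
    refine abs_shellMean_sub_le hc hφc fun z hz1 _ => ?_
    rw [show fderiv ℝ P (y + z) e = ⟪gradient P (y + z), e⟫ by
      rw [gradient, InnerProductSpace.toDual_symm_apply], ← inner_sub_left]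
    have hyz : Rg ≤ ‖y + z‖ := by
      have h := norm_sub_norm_le z (-y)
      have : ‖z - -y‖ = ‖y + z‖ := by rw [sub_neg_eq_add, add_comm]
      rw [this, norm_neg] at h
      linarith
    calc |⟪gradient P (y + z) - g, e⟫| ≤ ‖gradient P (y + z) - g‖ * ‖e‖ := abs_real_inner_le_norm _ _
      _ ≤ ε * ‖e‖ := mul_le_mul_of_nonneg_right (hRg _ hyz) (norm_nonneg _)
  -- assembling: `|∂ₑP(y) − ⟪g,e⟫| ≤ A₁ c₀ + 2 A₂ c₀^{1-q} + (arbitrarily small)`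
  set Λ₁ : ℝ := ∫ w : EuclideanSpace ℝ (Fin 3), |newtonFarLaplacian 1 2 w| with hΛ₁
  have hΛ₁0 : 0 ≤ Λ₁ := integral_nonneg fun _ => abs_nonneg _
  have hmain : |fderiv ℝ P y e - ⟪g, e⟫| ≤ A₁ * c₀ + 2 * A₂ * c₀ ^ (1 - q) := by
    refine le_of_forall_pos_le_add fun ε hε => ?_
    -- split ε
    set ε' : ℝ := ε / (2 * (1 + Λ₁ * ‖e‖)) with hε'
    have hε'pos : 0 < ε' := by positivity
    obtain ⟨N₁, hN₁⟩ := (Metric.tendsto_atTop.1 hlim_down) ε' hε'pos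
    obtain ⟨N₂, hN₂⟩ := hlim_up ε' hε'pos
    have h1 : |fderiv ℝ P y e - S (c₀ / 2 ^ N₁)| ≤ ε' := by
      rw [abs_sub_comm]; exact le_of_lt (hN₁ N₁ le_rfl)
    have h2 := hdown N₁
    have h3 := hup N₂
    have h4 := hN₂ N₂ le_rfl
    have hc₀q : 0 ≤ c₀ ^ (1 - q) := Real.rpow_nonneg hc₀pos.le _
    have h2' : |S (c₀ / 2 ^ N₁) - S c₀| ≤ A₁ * c₀ := by
      refine h2.trans (mul_le_mul_of_nonneg_left ?_ hA₁0)
      have : 0 ≤ c₀ / 2 ^ N₁ := by positivity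
      linarith
    have h3' : |S c₀ - S (c₀ * 2 ^ N₂)| ≤ 2 * A₂ * c₀ ^ (1 - q) := by
      refine h3.trans ?_
      have : 0 ≤ (1 : ℝ) / 2 ^ N₂ := by positivity
      nlinarith [mul_nonneg (mul_nonneg (by norm_num : (0:ℝ) ≤ 2) hA₂0) hc₀q]
    have hεsum : ε' + Λ₁ * (ε' * ‖e‖) ≤ ε := by
      rw [hε']
      have hden : 0 < 2 * (1 + Λ₁ * ‖e‖) := by positivity
      rw [show ε / (2 * (1 + Λ₁ * ‖e‖)) + Λ₁ * (ε / (2 * (1 + Λ₁ * ‖e‖)) * ‖e‖) =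
        ε * ((1 + Λ₁ * ‖e‖) / (2 * (1 + Λ₁ * ‖e‖))) by field_simp]
      rw [show (1 + Λ₁ * ‖e‖) / (2 * (1 + Λ₁ * ‖e‖)) = 1 / 2 by field_simp]
      linarith
    have htri : |fderiv ℝ P y e - ⟪g, e⟫| ≤ |fderiv ℝ P y e - S (c₀ / 2 ^ N₁)| +
        |S (c₀ / 2 ^ N₁) - S c₀| + |S c₀ - S (c₀ * 2 ^ N₂)| + |S (c₀ * 2 ^ N₂) - ⟪g, e⟫| := by
      have t1 := abs_sub_le (fderiv ℝ P y e) (S (c₀ / 2 ^ N₁)) ⟪g, e⟫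
      have t2 := abs_sub_le (S (c₀ / 2 ^ N₁)) (S c₀) ⟪g, e⟫
      have t3 := abs_sub_le (S c₀) (S (c₀ * 2 ^ N₂)) ⟪g, e⟫
      linarith
    linarith
  -- cosmetics: `A₁ c₀ ≤ 16 C K₂ 2^q V₁ (1+‖y‖)^{1-q} ‖e‖`, `2 A₂ c₀^{1-q} = 12 … (‖y‖/8)^{1-q} ‖e‖`
  have hcos1 : A₁ * c₀ ≤ 16 * C * K₂ * 2 ^ q * V₁ * (1 + ‖y‖) ^ (1 - q) * ‖e‖ := by
    have h1ypos : (0 : ℝ) < 1 + ‖y‖ := by positivity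
    have hK : 0 ≤ 16 * C * K₂ * 2 ^ q * V₁ * ‖e‖ := by positivity
    have hle : ‖y‖ ≤ 1 + ‖y‖ := by linarith
    have e1 : A₁ * c₀ = 16 * C * K₂ * 2 ^ q * V₁ * ‖e‖ * ‖y‖ / (1 + ‖y‖) ^ q := by
      rw [hA₁, hc₀]; field_simp; ring
    have e2 : 16 * C * K₂ * 2 ^ q * V₁ * (1 + ‖y‖) ^ (1 - q) * ‖e‖ =
        16 * C * K₂ * 2 ^ q * V₁ * ‖e‖ * (1 + ‖y‖) / (1 + ‖y‖) ^ q := by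
      rw [Real.rpow_sub h1ypos, Real.rpow_one]; field_simp
    rw [e1, e2]
    exact div_le_div_of_nonneg_right (mul_le_mul_of_nonneg_left hle hK) h1y.le
  have hcos2 : 2 * A₂ * c₀ ^ (1 - q) =
      12 * C * K₂ * V₁ * (20 : ℝ) ^ (3 - q) / (3 - q) * (‖y‖ / 8) ^ (1 - q) * ‖e‖ := by
    rw [hA₂, hc₀]; ring
  calc |fderiv ℝ P y e - ⟪g, e⟫| ≤ A₁ * c₀ + 2 * A₂ * c₀ ^ (1 - q) := hmain
    _ ≤ 16 * C * K₂ * 2 ^ q * V₁ * (1 + ‖y‖) ^ (1 - q) * ‖e‖ +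
          12 * C * K₂ * V₁ * (20 : ℝ) ^ (3 - q) / (3 - q) * (‖y‖ / 8) ^ (1 - q) * ‖e‖ := by
        rw [← hcos2]; exact add_le_add hcos1 le_rfl
    _ = _ := by ring

end TypeIRate

end Summit.NavierStokesRegularity.NavierStokesRegularity.Theorems.CoriolisHead

end
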